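import Literature.NumberTheory.DiophantineGeometry.ConductorFactorizationProofs
import Literature.NumberTheory.DiophantineGeometry.ConductorExponentLeEightProofs
import Literature.NumberTheory.DiophantineGeometry.ConductorExponentLeTwoProofs
import Literature.NumberTheory.EllipticCurves.RootNumberProofs
import Literature.NumberTheory.EllipticCurves.RootNumberTwistSemistableProofs
import Literature.NumberTheory.EllipticCurves.BurungaleSkinner2023.Curve14a1TwistsCertificate
import HarnessLib

/-!
# Route `TwistFamilyManinDescent`, crux `IsogenyTableFamiliesManinOne` (stmt-BirchSwinnertonDyer-25137): the crude
# CONDUCTOR SUPPORT BOUND used to put the inner twists of a `j`-family into Cremona's range (`--supports`)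

THEOREMS ONLY, route-independent bookkeeping (no definition, no named fact, no `sorry`).
* `conductorNorm_dvd_of_good_outside` — if an elliptic `V/ℚ` has good reduction at every prime outside `{2} ∪ S`
  with `S` a finite set of primes `≥ 5`, then `N(V) ∣ 2⁸ · ∏_{q ∈ S} q²`, granted as an integer `B` with `2⁸ ∣ B`
  and `q² ∣ B` for `q ∈ S` (`f₂ ≤ 8`, `f_q ≤ 2` at `q ≥ 5`: the tree theorems `conductorExponent_le_eight_holds`,
  `conductorExponent_le_two_of_five_le_natGenerator_holds`; `f_q = 0` at good `q`; `N = ∏ p^{f_p}`).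
* `hasGoodReductionAtPrime_quadraticTwist_baseChange_int_of_not_dvd` — for an integral model `W₀/ℤ`, an odd prime
  `q ∤ Δ(W₀)·d` is a prime of good reduction of `W₀ ⊗ d` (unit twist of a curve of good reduction).
Nothing about Manin constants or BSD is proved here.
-/

set_option autoImplicit false
-- D-0017: single-problem summit, so `Summit.BirchSwinnertonDyer.BirchSwinnertonDyer.…` repeats a namespace BY DESIGN.
set_option linter.dupNamespace false

noncomputable section

open scoped Classical

open WeierstrassCurve IsDedekindDomain Rat.HeightOneSpectrum

namespace Summit.BirchSwinnertonDyer.BirchSwinnertonDyer.Theorems.TwistFamilyManinDescent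

/-- **`N(V) ∣ B` from the support of the bad primes.** `V/ℚ` elliptic, `S` a finite set of primes `≥ 5` such that
`V` has good reduction at every prime `q ∉ S`, `q ≠ 2`; `B ≠ 0` with `2⁸ ∣ B` and `q² ∣ B` for `q ∈ S`. Then
`N(V) ∣ B`: `N = ∏_p p^{f_p}` with `f₂ ≤ 8` (Brumer–Kramer / Silverman ATAEC IV.10.4), `f_q ≤ 2` for `q ≥ 5`, and
`f_q = 0` at the good primes; distinct prime powers are coprime. [cite: SilvermanATAEC1994, IV.10.4 and IV.11]
[cite: SilvermanAEC2009, C.16] -/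
theorem conductorNorm_dvd_of_good_outside (V : WeierstrassCurve ℚ) [V.IsElliptic] (S : Finset ℕ)
    (hS5 : ∀ q ∈ S, 5 ≤ q) (hgood : ∀ (q : ℕ) (hq : q.Prime), q ≠ 2 → q ∉ S →
      (haveI := Fact.mk hq; V.HasGoodReductionAtPrime q))
    (B : ℕ) (hB0 : B ≠ 0) (hB2 : 2 ^ 8 ∣ B) (hBS : ∀ q ∈ S, q ^ 2 ∣ B) :
    V.conductorNorm ℤ ∣ B := by
  set N := V.conductorNorm ℤ with hN
  have hN0 : N ≠ 0 := (V.conductorNorm_pos_holds).ne'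
  -- compare factorisations prime by prime
  refine (Nat.factorization_le_iff_dvd hN0 hB0).mp (Finsupp.le_def.mpr fun p ↦ ?_)
  by_cases hpP : p.Prime
  swap
  · rw [Nat.factorization_eq_zero_of_not_prime _ hpP]; exact Nat.zero_le _
  haveI := Fact.mk hpP
  -- `N.factorization p = f_p`
  set v : HeightOneSpectrum ℤ := (primesEquiv (R := ℤ)).symm ⟨p, hpP⟩ with hv
  have hgen : natGenerator v = p := congrArg Subtype.val ((primesEquiv (R := ℤ)).apply_symm_apply ⟨p, hpP⟩)
  have hfact : N.factorization p = V.conductorExponent v := by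
    rw [← hgen]; exact V.factorization_conductorNorm_holds v
  rw [hfact]
  refine (hpP.pow_dvd_iff_le_factorization hB0).mp ?_
  by_cases hp2 : p = 2
  · subst hp2
    exact (Nat.pow_dvd_pow 2 (V.conductorExponent_le_eight_holds v)).trans hB2
  by_cases hpS : p ∈ S
  · have h5 : 5 ≤ natGenerator v := by rw [hgen]; exact hS5 p hpS
    exact (Nat.pow_dvd_pow p (V.conductorExponent_le_two_of_five_le_natGenerator_holds v h5)).trans (hBS p hpS)
  · -- good reduction at `p`: `f_p = 0`
    haveI : PerfectField (IsLocalRing.ResidueField (v.adicCompletionIntegers ℚ)) := PerfectField.ofFinite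
    have hg : V.HasGoodReductionAt v :=
      (V.hasGoodReductionAtPrime_iff_hasGoodReductionAt_holds ⟨p, hpP⟩).mp (hgood p hpP hp2 hpS)
    have h0 : V.conductorExponent v = 0 := (V.conductorExponent_eq_zero_iff_holds v).mpr hg
    rw [h0, pow_zero]
    exact one_dvd B

/-- **Good reduction of a unit twist of an integral model, at an odd prime off the discriminant.** For `W₀/ℤ` with
`W₀ ⊗ ℚ` elliptic, an integer `d`, and an odd prime `q` with `q ∤ Δ(W₀)` and `q ∤ d`: `(W₀ ⊗ ℚ) ⊗ d` has good
reduction at `q` (`q ∤ Δ` gives good reduction of `W₀`, Silverman *AEC* VII.5 Prop. 5.1(a); a twist by a `q`-adic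
unit keeps it, VII.1 Prop. 1.3(b)). [cite: SilvermanAEC2009, VII.5 Prop. 5.1 and VII.1 Prop. 1.3] -/
theorem hasGoodReductionAtPrime_quadraticTwist_baseChange_int_of_not_dvd (W₀ : WeierstrassCurve ℤ)
    [(W₀.baseChange ℚ).IsElliptic] {q : ℕ} [hq : Fact q.Prime] (hq2 : q ≠ 2)
    (hΔ : ¬ (q : ℤ) ∣ W₀.Δ) {d : ℤ} (hd : ¬ (q : ℤ) ∣ d) :
    ((W₀.baseChange ℚ).quadraticTwist (d : ℚ)).HasGoodReductionAtPrime q := by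
  have hqP : q.Prime := hq.out
  set v : HeightOneSpectrum ℤ := (primesEquiv (R := ℤ)).symm ⟨q, hqP⟩ with hv
  have hgen : natGenerator v = q := congrArg Subtype.val ((primesEquiv (R := ℤ)).apply_symm_apply ⟨q, hqP⟩)
  have hd0 : (d : ℚ) ≠ 0 := by
    have : d ≠ 0 := fun h ↦ hd (by rw [h]; exact dvd_zero _)
    exact_mod_cast this
  haveI := (W₀.baseChange ℚ).isElliptic_quadraticTwist hd0
  have hgood : (W₀.baseChange ℚ).HasGoodReductionAt v :=
    Literature.NumberTheory.EllipticCurves.BurungaleSkinner2023.hasGoodReductionAt_baseChange_int_of_not_dvd W₀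
      (by rw [hgen]; exact hΔ)
  obtain ⟨hg, -, -⟩ := (W₀.baseChange ℚ).hasReductionAt_quadraticTwist_iff_of_not_dvd v
    (by rw [hgen]; exact hq2) (d := d) (by rw [hgen]; exact hd)
  exact (((W₀.baseChange ℚ).quadraticTwist (d : ℚ)).hasGoodReductionAtPrime_iff_hasGoodReductionAt_holds
    ⟨q, hqP⟩).mpr (hg.mpr hgood)

end Summit.BirchSwinnertonDyer.BirchSwinnertonDyer.Theorems.TwistFamilyManinDescent

end
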